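import Literature.MathematicalPhysics.QuantumFieldTheory.Balaban1983to89.B7Prop7OneStep
import Literature.MathematicalPhysics.QuantumFieldTheory.Balaban1983to89.B7Prop3GeneralLinearBound

/-!
# `Balaban1983to89.B7Prop7LinearBound` — T. Bałaban, *Averaging operations for lattice gauge theories*, Commun. Math. Phys. **98**
(1985) 17–51 [Balaban1985Averaging]: PROPOSITION 7 (p. 43) — «the only change in the inequality (126), where the constant
e^{O(1)L²α₀} on the right-hand side is replaced by e^{O(1)(L²α₀+Lα₁)}»: THE LINEAR PART (124)–(126) AT THE COMPLEX BACKGROUND `U″V₀`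

statement-level skeleton of published theorems with citation tags; proofs where landed; nothing here is a claim about the Yang–Mills mass gap

PDF held: `paper:balaban1985-cmp98-averaging` (journal page = PDF page + 16); p. 43 read on the render
`b2b-balaban-ref1/pages/1985-cmp98-averaging/1985-cmp98-averaging-p027-x2.png`; p. 36 ((124)–(126)) through the quotations of
`B7Prop3GeneralLinearBound` (whose architecture this file mirrors line by line).

CITATION HEADER (lean-in-tree rule).  Cell `lit-balaban`, unit `lit-balaban-r04` (B7 block owner, gen 4; TAKING line HOME/STATUS.md
2026-08-21T04:30:51Z) — KERNEL PIECE for SKELETON row **`B7.Prop7`**: the one-step LINEAR bound at the complex background with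
LEADING COEFFICIENT EXACTLY `L` (un-normalised currency), the input `hlin` of the `k`-level induction `B7Prop4GeneralInduction.prop4_induction`.

PRINT (p. 43).  «Let us analyze the proof of Proposition 3 first. The bounds depend on bounds of the quantities Y_x = (1/i) log
V₀(Γ_{c,x} ∪ (−c)). Previously we had |Y_x| = O(L²α₀), but now we allow complex perturbations V′V₀ of V₀, and for these we have
|Y_x| = O(L²α₀ + Lα₁). Thus Proposition 3 holds unifirmly [sic] for V′V₀ instead of V₀ and with the only change in the inequality
(126), where the constant e^{O(1)L²α₀} on the right-hand side is replaced by e^{O(1)(L²α₀+Lα₁)}.»  (126) p. 36: «|(Q(V₀)A)_c| ≦ |A| +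
O(1)L²α₀|A| < (1 + O(1)L²α₀)α₁ < e^{O(1)L²α₀}α₁.»

WHAT THIS FILE PROVES (kernel, no `sorry`, standard axioms; theorems only).  `B7Prop3GeneralLinearBound` proves (126) for a `U1`
background (rotations by background transports are isometries).  Here the background `W` has bond variables of norm `≤ M` (`M = 1 + u`
for `W = U″V₀`, `‖U″ − 1‖, ‖U″⁻¹ − 1‖ ≤ u`), and every rotation costs a factor `‖X‖‖X⁻¹‖` — print's census item (b) «|R(W)A| ≤ |W||W⁻¹||A|
≤ e^{O(1)Lα₁}|A|»:
* §1 `norm_conjR_le_mul`, `norm_tsum_le_general` (`‖(R^{W}_{0,y}A)(Γ)‖ ≤ |Γ|·M^{2|Γ|}·a`), `norm_Q0cov_le_general` (the main term (125):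
  `‖(Q₀A)_c‖ ≤ Λ·a` for `M^{2(2d+2)L} ≤ Λ`), the defects `norm_conjR_sub_self_le_general` (`‖R(X)Z − Z‖ ≤ 4ε‖Z‖` for ANY unit `X` within
  `ε ≤ 1/8` of `1`) and `norm_Dmlog_mul_right_sub_self_le_general` (`≤ 10ε‖Z‖`).
* §2 the three brackets of `B7Prop3GeneralLinearSplit.linQcov_split` (hypothesis-light: only `‖W_x − 1‖ < 1`) at `W`:
  `56(d+1)·εΛ·La`, `12·εΛ·La`, `12d·εΛ·La`; **`norm_linQcov_le_general`**: `‖L(Q(W)A)_c‖ ≤ Λ(1 + 68(d+1)ε)·L·a`.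
* §3 **`norm_linQcov_cplx_le`** — (126) AT THE COMPLEX BACKGROUND `U″V₀`: for `V₀ ∈ U1` with block loops at `c` within `α ≤ 1/16`
  of `1`, `U″` within `u` of `1` with `s := (2d+2)L·u ≤ 1/512`, `sup_b|A_b| ≤ a`:
  `‖L(Q(U″V₀)A)_c‖ ≤ (1 + 70(d+1)·α + 150(d+1)·s)·L·a` — print's `(1 + O(1)(L²α₀ + Lα₁))|A|` with `α = O(L²α₀)` (Prop. 1) and
  `s = 2(d+1)L·u = O(Lα₁)`, LEADING COEFFICIENT EXACTLY `L`, constants depending on `d` only; `_of_pdev` (plaquette currency).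
NOT CLAIMED: sharper constants; the `k`-level induction (sequel `B7Prop7Levels`).
REUSED BY NAME: `B7Prop3GeneralLinearSplit.linQcov_split / sum_blockWeight`, `B7Prop3GeneralLinearBound.norm_Xavg_le / norm_wsum_le /
norm_conjR_expUnit_sub_self_le / norm_PhiY_sub_self_le / Dmlog_mul_right_eq`, `B12AverageCorridor267.norm_PsiW_sub_one_le`,
`B7Prop3GeneralRotated.tsum / tstep / conjR_mul_left`, `B7Prop3GeneralTild.Aloop / DXavg`, `B7Prop3GeneralLinear.Q0cov / linQcov`,
`B7Prop7OneStep.norm_hol_le_pow / norm_bond_cplx_le / norm_tHol_pert_sub_one_le / norm_units_conj_sub_one_le_mul`,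
`B7Prop1Explicit.Wcx / Wcx_mul_eq_tHol_mul / exp_sub_one_le_of_le`, `B7Eq123General.blockLoops_of_pdev`.
Unit `lit-balaban-r04` (gen 4), 2026-08-21.

v1.1 (unit `lit-balaban-r04` gen 22, DOCSTRING-ONLY; every declaration byte-identical with v1.0 p249117): the locator of (27) corrected
from "p.21" to p. 22 in one `[cite:]` tag (own-stem locator audit of the `[cite: Balaban1985Averaging, …]` tags against a display→page map
of CMP 98 built from the held text layer `paper:balaban1985-cmp98-averaging` and verified on the ×2 renders
`…/1985-cmp98-averaging-p0NN-x2.png`: (26)–(27) are the first displays of p. 22 (render p006, after «For matrices X satisfying |X − 1| ≦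
½, we have»); p. 21 ends with (25)).

[cite: Balaban1985Averaging, Proposition 7 p.43, (126) p.36]
-/

noncomputable section

open scoped BigOperators
open NormedSpace Finset

namespace Literature.MathematicalPhysics.QuantumFieldTheory.Balaban1983to89.B7Prop7LinearBound

open B7Prop1Explicit B7Prop2Explicit B7Prop3Flat B7Eq92Concrete MatrixLog B7Prop3GeneralRotated B7Prop3GeneralLinear
  B7Prop3GeneralTild B7Prop3GeneralLinearSplit B7Prop3GeneralLinearBound B7Prop3GeneralAnalytic B7Eq123General B7Prop7OneStep
open B7Eq78Linearization (conjR conjR_apply conjR_sub conjR_one)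
open B12AverageCorridor267 (Dmlog PhiY PhiY_apply PsiW PsiW_apply norm_PsiW_sub_one_le)

-- `Site` alone would resolve to the torus sites of `Setup.lean`; re-export the `ℤ^d` sites of `B7Prop1Explicit`.
export B7Prop1Explicit (Site)

variable {d : ℕ}

variable {𝔸 : Type*} [NormedRing 𝔸] [NormedAlgebra ℂ 𝔸] [NormOneClass 𝔸] [CompleteSpace 𝔸]
variable (L : ℕ)

/-! ## §1 Rotations by non-unitary transports: path sums, the main term, the defect operators -/

section Rotations

omit [NormedAlgebra ℂ 𝔸] [NormOneClass 𝔸] [CompleteSpace 𝔸] in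
/-- «|R(W)A| ≤ |W||W⁻¹||A|» (census item (b) of `B7.Prop7Printed`). [cite: Balaban1985Averaging, Proposition 7 p.43, (57) p.27] -/
theorem norm_conjR_le_mul (X : 𝔸ˣ) (Z : 𝔸) : ‖conjR X Z‖ ≤ ‖(X : 𝔸)‖ * ‖((X⁻¹ : 𝔸ˣ) : 𝔸)‖ * ‖Z‖ := by
  rw [conjR_apply]
  calc ‖(X : 𝔸) * Z * ((X⁻¹ : 𝔸ˣ) : 𝔸)‖ ≤ ‖(X : 𝔸)‖ * ‖Z‖ * ‖((X⁻¹ : 𝔸ˣ) : 𝔸)‖ :=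
        (norm_mul_le _ _).trans (mul_le_mul_of_nonneg_right (norm_mul_le _ _) (norm_nonneg _))
    _ = ‖(X : 𝔸)‖ * ‖((X⁻¹ : 𝔸ˣ) : 𝔸)‖ * ‖Z‖ := by ring

variable {W : Site d → Fin d → 𝔸ˣ} {M : ℝ} (hM : 1 ≤ M)
  (hWb : ∀ x κ, ‖((W x κ : 𝔸ˣ) : 𝔸)‖ ≤ M ∧ ‖(((W x κ)⁻¹ : 𝔸ˣ) : 𝔸)‖ ≤ M)
  {A : Site d → Fin d → 𝔸} {a : ℝ} (ha : 0 ≤ a) (hA : ∀ x κ, ‖A x κ‖ ≤ a)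

omit [NormedAlgebra ℂ 𝔸] [CompleteSpace 𝔸] in
include hM hWb in
/-- rotation by a transport `W(Γ)` costs `M^{2|Γ|}`: `‖R(W(Γ))Z‖ ≤ M^{2|Γ|}‖Z‖` (`B7Prop7OneStep.norm_hol_le_pow`).
[cite: Balaban1985Averaging, Proposition 7 p.43, (57) p.27] -/
theorem norm_conjR_hol_le (y : Site d) (w : List (Letter d)) (Z : 𝔸) :
    ‖conjR (hol W y w) Z‖ ≤ M ^ (2 * w.length) * ‖Z‖ := by
  obtain ⟨h1, h2⟩ := norm_hol_le_pow (by linarith) hWb w y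
  refine (norm_conjR_le_mul _ Z).trans ?_
  have h := mul_le_mul h1 h2 (norm_nonneg _) (pow_nonneg (by linarith) _)
  rw [← pow_add, ← two_mul] at h
  exact mul_le_mul_of_nonneg_right h (norm_nonneg _)

omit [NormedAlgebra ℂ 𝔸] [NormOneClass 𝔸] [CompleteSpace 𝔸] in
include hM hWb ha hA in
/-- **the rotated path sums over a non-unitary background**: `‖(R^{W}_{0,y}A)(Γ)‖ ≤ |Γ|·M^{2|Γ|}·a` (each bond contributes a
rotated `A_b`, each further letter is rotated by one background bond: `U1` twin `B7Prop3GeneralRotated.norm_tsum_le`).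
[cite: Balaban1985Averaging, Proposition 7 p.43, (125)–(126) p.36] -/
theorem norm_tsum_le_general : ∀ (x : Site d) (w : List (Letter d)),
    ‖tsum W A x w‖ ≤ w.length * M ^ (2 * w.length) * a
  | x, [] => by simp
  | x, l :: w => by
    have ih := norm_tsum_le_general (x + l.vec) w
    have hM0 : 0 ≤ M := by linarith
    have hs : ‖((stepHol W x l : 𝔸ˣ) : 𝔸)‖ ≤ M ∧ ‖(((stepHol W x l)⁻¹ : 𝔸ˣ) : 𝔸)‖ ≤ M := by
      obtain ⟨μ, b⟩ := l
      cases b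
      · rw [stepHol_false, inv_inv]; exact ⟨(hWb _ μ).2, (hWb _ μ).1⟩
      · rw [stepHol_true]; exact hWb x μ
    have hstep : ‖tstep W A x l‖ ≤ M ^ 2 * a := by
      unfold tstep
      split_ifs
      · have hM2 : 1 ≤ M ^ 2 := by nlinarith
        calc ‖A x l.1‖ ≤ a := hA _ _
          _ ≤ M ^ 2 * a := le_mul_of_one_le_left ha hM2
      · rw [norm_neg]
        refine (norm_conjR_le_mul _ _).trans ?_
        have h := mul_le_mul (mul_le_mul hs.1 hs.2 (norm_nonneg _) hM0) (hA (x + l.vec) l.1) (norm_nonneg _)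
          (by positivity)
        refine h.trans (le_of_eq ?_); ring
    have hrot : ‖conjR (stepHol W x l) (tsum W A (x + l.vec) w)‖ ≤ M ^ 2 * (w.length * M ^ (2 * w.length) * a) := by
      refine (norm_conjR_le_mul _ _).trans ?_
      have h := mul_le_mul (mul_le_mul hs.1 hs.2 (norm_nonneg _) hM0) ih (norm_nonneg _) (by positivity)
      refine h.trans (le_of_eq ?_); ring
    rw [tsum_cons, List.length_cons]
    refine (norm_add_le _ _).trans ((add_le_add hstep hrot).trans ?_)
    have hpow : M ^ 2 ≤ M ^ (2 * (w.length + 1)) := pow_le_pow_right₀ hM (by omega)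
    have e : M ^ 2 * (w.length * M ^ (2 * w.length) * a) = w.length * M ^ (2 * (w.length + 1)) * a := by
      rw [show 2 * (w.length + 1) = 2 * w.length + 2 by ring, pow_add]; ring
    rw [e]
    push_cast
    nlinarith [mul_le_mul_of_nonneg_right hpow ha, pow_nonneg hM0 (2 * (w.length + 1))]

omit [CompleteSpace 𝔸] in
include hM hWb ha hA in
/-- **the main term (125) at a non-unitary background**: `‖(Q₀A)_c‖ ≤ Λ·a` whenever `M^{2(2d+2)L} ≤ Λ` (each of the `L^d` summands is a
straight-segment sum rotated along a tree contour, `|Γ_{c₋,x}| + L ≤ (2d+2)L` bonds in all) — print's «|(Q₀A)_c| ≦ |A|» acquires the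
factor «|W||W⁻¹| ≤ e^{O(1)Lα₁}». [cite: Balaban1985Averaging, Proposition 7 p.43, (125)–(126) p.36] -/
theorem norm_Q0cov_le_general (hL : 1 ≤ L) {Λ : ℝ} (hΛ : M ^ (2 * (2 * (d * L) + L + L)) ≤ Λ) (q : Site d) (κ : Fin d) :
    ‖Q0cov L W A q κ‖ ≤ Λ * a := by
  have hLpos : (0 : ℝ) < L := by exact_mod_cast hL
  have hM0 : 0 ≤ M := by linarith
  have hterm : ∀ r : Fin d → Fin L,
      ‖conjR (hol W q (treeWord (boxVec L r))) (tsum W A (q + boxVec L r) (seg κ L))‖ ≤ Λ * (L * a) := by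
    intro r
    refine (norm_conjR_hol_le hM hWb q _ _).trans ?_
    have ht := norm_tsum_le_general hM hWb ha hA (q + boxVec L r) (seg κ L)
    rw [length_seg, Int.natAbs_natCast] at ht
    rw [length_treeWord]
    have hl := l1_boxVec_le L r
    have hpow : M ^ (2 * l1 (boxVec L r)) * M ^ (2 * L) ≤ Λ := by
      rw [← pow_add]
      exact (pow_le_pow_right₀ hM (by nlinarith)).trans hΛ
    calc M ^ (2 * l1 (boxVec L r)) * ‖tsum W A (q + boxVec L r) (seg κ ↑L)‖
        ≤ M ^ (2 * l1 (boxVec L r)) * (L * M ^ (2 * L) * a) := mul_le_mul_of_nonneg_left ht (pow_nonneg hM0 _)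
      _ = (M ^ (2 * l1 (boxVec L r)) * M ^ (2 * L)) * (L * a) := by ring
      _ ≤ Λ * (L * a) := mul_le_mul_of_nonneg_right hpow (by positivity)
  unfold Q0cov
  calc ‖∑ r : Fin d → Fin L, (((L : ℝ) ^ (d + 1))⁻¹) •
          conjR (hol W q (treeWord (boxVec L r))) (tsum W A (q + boxVec L r) (seg κ L))‖
      ≤ ∑ r : Fin d → Fin L, (((L : ℝ) ^ (d + 1))⁻¹) * (Λ * (L * a)) := by
        refine norm_sum_le_of_le _ fun r _ => ?_
        rw [norm_smul, Real.norm_of_nonneg (by positivity)]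
        exact mul_le_mul_of_nonneg_left (hterm r) (by positivity)
    _ = Λ * a := by
        rw [Finset.sum_const, Finset.card_univ, Fintype.card_pi, Finset.prod_const, Finset.card_univ,
          Fintype.card_fin, Fintype.card_fin, nsmul_eq_mul, Nat.cast_pow, pow_succ]
        field_simp

omit [NormedAlgebra ℂ 𝔸] [CompleteSpace 𝔸] in
/-- a unit within `x ≤ 1/2` of `1` has its inverse within `2x` of `1` (`X⁻¹ − 1 = X⁻¹(1 − X)`). [cite: Balaban1985Averaging, (27) p.22] -/
theorem norm_units_inv_sub_one_le_two_mul (X : 𝔸ˣ) {x : ℝ} (hX : ‖(X : 𝔸) - 1‖ ≤ x) (hx : x ≤ 1 / 2) :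
    ‖((X⁻¹ : 𝔸ˣ) : 𝔸) - 1‖ ≤ 2 * x := by
  set z := ‖((X⁻¹ : 𝔸ˣ) : 𝔸) - 1‖ with hz
  have h : ((X⁻¹ : 𝔸ˣ) : 𝔸) - 1 = ((X⁻¹ : 𝔸ˣ) : 𝔸) * (1 - (X : 𝔸)) := by
    rw [mul_sub, mul_one, Units.inv_mul]
  have hn : ‖((X⁻¹ : 𝔸ˣ) : 𝔸)‖ ≤ 1 + z := by
    have h' := norm_add_le (((X⁻¹ : 𝔸ˣ) : 𝔸) - 1) (1 : 𝔸)
    rw [sub_add_cancel, norm_one] at h'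
    linarith
  have h1 : z ≤ (1 + z) * x := by
    calc z = ‖((X⁻¹ : 𝔸ˣ) : 𝔸) * (1 - (X : 𝔸))‖ := by rw [hz, h]
      _ ≤ ‖((X⁻¹ : 𝔸ˣ) : 𝔸)‖ * ‖1 - (X : 𝔸)‖ := norm_mul_le _ _
      _ ≤ (1 + z) * x := by
          rw [norm_sub_rev]
          exact mul_le_mul hn hX (norm_nonneg _) (by positivity)
  have hz0 : 0 ≤ z := norm_nonneg _
  nlinarith

omit [NormedAlgebra ℂ 𝔸] [CompleteSpace 𝔸] in
/-- **the rotation defect for a NON-unitary loop**: `‖R(X)Z − Z‖ ≤ 4ε‖Z‖` for any unit `X` with `‖X − 1‖ ≤ ε ≤ 1/8` (`U1` twin with `2ε`: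
`B7Prop3GeneralLinearBound.norm_conjR_sub_self_le`) — print's operators «equal to 1 for z = 0», now at the complex loops `W_x`.
[cite: Balaban1985Averaging, Proposition 7 p.43, (124)–(126) p.36] -/
theorem norm_conjR_sub_self_le_general {X : 𝔸ˣ} {ε : ℝ} (hX : ‖(X : 𝔸) - 1‖ ≤ ε) (hε : ε ≤ 1 / 8) (Z : 𝔸) :
    ‖conjR X Z - Z‖ ≤ 4 * ε * ‖Z‖ := by
  have hε0 : 0 ≤ ε := (norm_nonneg _).trans hX
  have hinv : ‖((X⁻¹ : 𝔸ˣ) : 𝔸) - 1‖ ≤ 2 * ε := norm_units_inv_sub_one_le_two_mul X hX (by linarith)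
  have hin : ‖((X⁻¹ : 𝔸ˣ) : 𝔸)‖ ≤ 1 + 2 * ε := by
    have h' := norm_add_le (((X⁻¹ : 𝔸ˣ) : 𝔸) - 1) (1 : 𝔸)
    rw [sub_add_cancel, norm_one] at h'
    linarith
  have hsplit : conjR X Z - Z = ((X : 𝔸) - 1) * Z * ((X⁻¹ : 𝔸ˣ) : 𝔸) + Z * (((X⁻¹ : 𝔸ˣ) : 𝔸) - 1) := by
    rw [conjR_apply]; noncomm_ring
  rw [hsplit]
  calc ‖((X : 𝔸) - 1) * Z * ((X⁻¹ : 𝔸ˣ) : 𝔸) + Z * (((X⁻¹ : 𝔸ˣ) : 𝔸) - 1)‖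
      ≤ ‖(X : 𝔸) - 1‖ * ‖Z‖ * ‖((X⁻¹ : 𝔸ˣ) : 𝔸)‖ + ‖Z‖ * ‖((X⁻¹ : 𝔸ˣ) : 𝔸) - 1‖ :=
        (norm_add_le _ _).trans (add_le_add ((norm_mul_le _ _).trans
          (mul_le_mul_of_nonneg_right (norm_mul_le _ _) (norm_nonneg _))) (norm_mul_le _ _))
    _ ≤ ε * ‖Z‖ * (1 + 2 * ε) + ‖Z‖ * (2 * ε) :=
        add_le_add (mul_le_mul (mul_le_mul_of_nonneg_right hX (norm_nonneg _)) hin (norm_nonneg _)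
          (mul_nonneg hε0 (norm_nonneg _))) (mul_le_mul_of_nonneg_left hinv (norm_nonneg _))
    _ ≤ 4 * ε * ‖Z‖ := by
        have h1 : ε * ε * ‖Z‖ ≤ 1 / 8 * ε * ‖Z‖ :=
          mul_le_mul_of_nonneg_right (mul_le_mul_of_nonneg_right hε hε0) (norm_nonneg Z)
        nlinarith [norm_nonneg Z, mul_nonneg hε0 (norm_nonneg Z)]

omit [NormedAlgebra ℂ 𝔸] [CompleteSpace 𝔸] in
/-- … and the rotated element stays comparable: `‖R(X)Z‖ ≤ (3/2)‖Z‖` for `‖X − 1‖ ≤ 1/8`. [cite: Balaban1985Averaging, Proposition 7 p.43, (57) p.27] -/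
theorem norm_conjR_le_three_halves {X : 𝔸ˣ} {ε : ℝ} (hX : ‖(X : 𝔸) - 1‖ ≤ ε) (hε : ε ≤ 1 / 8) (Z : 𝔸) :
    ‖conjR X Z‖ ≤ 3 / 2 * ‖Z‖ := by
  have h := norm_conjR_sub_self_le_general hX hε Z
  have h' := norm_add_le (conjR X Z - Z) Z
  rw [sub_add_cancel] at h'
  nlinarith [norm_nonneg Z, (norm_nonneg _).trans hX]

/-- **the `D log` defect for a NON-unitary loop**: `‖(D log)_X(ZX) − Z‖ ≤ 10ε‖Z‖` for any unit `X` with `‖X − 1‖ ≤ ε ≤ 1/8`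
(`‖Ψ_X − 1‖ ≤ 4ε` of `B12AverageCorridor267` on `R(X⁻¹)Z`, `‖R(X⁻¹)Z‖ ≤ (3/2)‖Z‖`, plus the rotation defect `4ε`; `U1` twin with `6ε`).
[cite: Balaban1985Averaging, Proposition 7 p.43, (124)–(126) p.36, (116) p.35] -/
theorem norm_Dmlog_mul_right_sub_self_le_general {X : 𝔸ˣ} {ε : ℝ} (hε : ε ≤ 1 / 8) (hX : ‖(X : 𝔸) - 1‖ ≤ ε) (Z : 𝔸) :
    ‖Dmlog (X : 𝔸) (Z * X) - Z‖ ≤ 10 * ε * ‖Z‖ := by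
  have hε0 : 0 ≤ ε := (norm_nonneg _).trans hX
  have hXi : ‖((X⁻¹ : 𝔸ˣ) : 𝔸) - 1‖ ≤ 2 * ε := norm_units_inv_sub_one_le_two_mul X hX (by linarith)
  -- the rotation by `X⁻¹`: defect `≤ ε(1 + …)` — we redo the two-term split with the roles of `X`, `X⁻¹` exchanged
  have hc : ‖conjR X⁻¹ Z - Z‖ ≤ 4 * ε * ‖Z‖ := by
    have hsplit : conjR X⁻¹ Z - Z = (((X⁻¹ : 𝔸ˣ) : 𝔸) - 1) * Z * (X : 𝔸) + Z * ((X : 𝔸) - 1) := by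
      rw [conjR_apply, inv_inv]; noncomm_ring
    have hXn : ‖(X : 𝔸)‖ ≤ 1 + ε := by
      have h' := norm_add_le ((X : 𝔸) - 1) (1 : 𝔸)
      rw [sub_add_cancel, norm_one] at h'
      linarith
    rw [hsplit]
    calc ‖(((X⁻¹ : 𝔸ˣ) : 𝔸) - 1) * Z * (X : 𝔸) + Z * ((X : 𝔸) - 1)‖
        ≤ ‖((X⁻¹ : 𝔸ˣ) : 𝔸) - 1‖ * ‖Z‖ * ‖(X : 𝔸)‖ + ‖Z‖ * ‖(X : 𝔸) - 1‖ :=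
          (norm_add_le _ _).trans (add_le_add ((norm_mul_le _ _).trans
            (mul_le_mul_of_nonneg_right (norm_mul_le _ _) (norm_nonneg _))) (norm_mul_le _ _))
      _ ≤ 2 * ε * ‖Z‖ * (1 + ε) + ‖Z‖ * ε :=
          add_le_add (mul_le_mul (mul_le_mul_of_nonneg_right hXi (norm_nonneg _)) hXn (norm_nonneg _)
            (by positivity)) (mul_le_mul_of_nonneg_left hX (norm_nonneg _))
      _ ≤ 4 * ε * ‖Z‖ := by
          have h1 : ε * ε * ‖Z‖ ≤ 1 / 8 * ε * ‖Z‖ :=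
            mul_le_mul_of_nonneg_right (mul_le_mul_of_nonneg_right hε hε0) (norm_nonneg Z)
          nlinarith [norm_nonneg Z, mul_nonneg hε0 (norm_nonneg Z)]
  have hcn : ‖conjR X⁻¹ Z‖ ≤ 3 / 2 * ‖Z‖ := by
    have h' := norm_add_le (conjR X⁻¹ Z - Z) Z
    rw [sub_add_cancel] at h'
    nlinarith [norm_nonneg Z]
  have h1 : ‖PsiW (X : 𝔸) (conjR X⁻¹ Z) - conjR X⁻¹ Z‖ ≤ 4 * ε * (3 / 2 * ‖Z‖) := by
    rw [show PsiW (X : 𝔸) (conjR X⁻¹ Z) - conjR X⁻¹ Z = (PsiW (X : 𝔸) - 1) (conjR X⁻¹ Z) from rfl]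
    refine (ContinuousLinearMap.le_opNorm _ _).trans ?_
    exact mul_le_mul (norm_PsiW_sub_one_le hX (by linarith)) hcn (norm_nonneg _) (by positivity)
  rw [Dmlog_mul_right_eq]
  calc ‖PsiW (X : 𝔸) (conjR X⁻¹ Z) - Z‖
      = ‖(PsiW (X : 𝔸) (conjR X⁻¹ Z) - conjR X⁻¹ Z) + (conjR X⁻¹ Z - Z)‖ := by rw [sub_add_sub_cancel]
    _ ≤ 4 * ε * (3 / 2 * ‖Z‖) + 4 * ε * ‖Z‖ := (norm_add_le _ _).trans (add_le_add h1 hc)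
    _ = 10 * ε * ‖Z‖ := by ring

end Rotations

/-! ## §2 The three brackets of (124) and (126) at a non-unitary background -/

section Brackets

variable {W : Site d → Fin d → 𝔸ˣ} {M : ℝ} (hM : 1 ≤ M)
  (hWb : ∀ x κ, ‖((W x κ : 𝔸ˣ) : 𝔸)‖ ≤ M ∧ ‖(((W x κ)⁻¹ : 𝔸ˣ) : 𝔸)‖ ≤ M)
  {A : Site d → Fin d → 𝔸} {a : ℝ} (ha : 0 ≤ a) (hA : ∀ x κ, ‖A x κ‖ ≤ a)
  (hL : 1 ≤ L) {Λ : ℝ} (hΛ : M ^ (2 * (2 * (d * L) + L + L)) ≤ Λ)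
  (q : Site d) (κ : Fin d) {ε : ℝ} (hε0 : 0 ≤ ε) (hε : ε ≤ 1 / 8)
  (hWl : ∀ r : Fin d → Fin L, ‖((Wcx L W q κ (boxVec L r) : 𝔸ˣ) : 𝔸) - 1‖ ≤ ε)

omit [NormedAlgebra ℂ 𝔸] [NormOneClass 𝔸] [CompleteSpace 𝔸] in
include hM hWb ha hA hΛ in
/-- path sums over words of `≤ (2d+2)L` letters: `‖(R^{W}A)(Γ)‖ ≤ |Γ|·Λ·a`. [cite: Balaban1985Averaging, Proposition 7 p.43, (126) p.36] -/
theorem norm_tsum_le_of_length (y : Site d) {w : List (Letter d)} (hw : w.length ≤ 2 * (d * L) + L + L) :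
    ‖tsum W A y w‖ ≤ w.length * Λ * a := by
  refine (norm_tsum_le_general hM hWb ha hA y w).trans ?_
  have hpow : M ^ (2 * w.length) ≤ Λ := (pow_le_pow_right₀ hM (by omega)).trans hΛ
  have := mul_le_mul_of_nonneg_left hpow (by positivity : (0 : ℝ) ≤ w.length * a)
  nlinarith

omit [NormedAlgebra ℂ 𝔸] [NormOneClass 𝔸] [CompleteSpace 𝔸] in
include hM hWb ha hA hΛ in
/-- `‖A_x^{(1)}‖ ≤ 2(d+1)L·Λ·a` (the loop `Γ_{c,x}∪(−c)` has `≤ 2(d+1)L` bonds). [cite: Balaban1985Averaging, Proposition 7 p.43, (115) p.34, (126) p.36] -/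
theorem norm_Aloop_le_general (r : Fin d → Fin L) : ‖Aloop L W A q κ (boxVec L r)‖ ≤ 2 * (d + 1) * L * Λ * a := by
  have hlen : (gammaWord L κ (boxVec L r) ++ seg κ (-(L : ℤ))).length ≤ 2 * (d * L) + L + L := by
    rw [List.length_append, length_gammaWord, length_seg, Int.natAbs_neg, Int.natAbs_natCast]
    have := l1_boxVec_le (L := L) r; omega
  refine (norm_tsum_le_of_length L hM hWb ha hA hΛ q hlen).trans ?_
  have hcast : (((gammaWord L κ (boxVec L r) ++ seg κ (-(L : ℤ))).length : ℕ) : ℝ) ≤ 2 * (d + 1) * L := by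
    have : (((2 * (d * L) + L + L : ℕ)) : ℝ) = 2 * (d + 1) * L := by push_cast; ring
    rw [← this]; exact_mod_cast hlen
  have hΛ0 : 0 ≤ Λ := le_trans (pow_nonneg (by linarith) _) hΛ
  nlinarith [mul_nonneg hΛ0 ha]

include hM hWb ha hA hL hΛ hε0 hε hWl in
/-- FIRST BRACKET at `W`: `≤ 56(d+1)·ε·Λ·L·a` (`U1` twin `40(d+1)εLa`: the `D log` defect is now `10ε`, the loops rotate by `Λ`).
[cite: Balaban1985Averaging, Proposition 7 p.43, (124)–(126) p.36] -/
theorem norm_bracket1_le_general :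
    ‖PhiY (Xavg L W q κ) (DXavg L W A q κ)
        - ∑ r : Fin d → Fin L, (((L : ℝ) ^ d)⁻¹) • Aloop L W A q κ (boxVec L r)‖
      ≤ 56 * (d + 1) * ε * Λ * L * a := by
  set ℓ : ℝ := 2 * (d + 1) * L * Λ * a with hℓ
  have hΛ0 : 0 ≤ Λ := le_trans (pow_nonneg (by linarith) _) hΛ
  have hℓ0 : 0 ≤ ℓ := by positivity
  have hX := norm_Xavg_le L hL W q κ hε hWl
  have hAl := norm_Aloop_le_general L hM hWb ha hA hΛ q κ
  set S := ∑ r : Fin d → Fin L, (((L : ℝ) ^ d)⁻¹) • Aloop L W A q κ (boxVec L r) with hS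
  have hin : ‖DXavg L W A q κ - S‖ ≤ 10 * ε * ℓ := by
    rw [hS, DXavg, ← Finset.sum_sub_distrib]
    simp_rw [← smul_sub]
    refine norm_wsum_le L hL fun r => ?_
    refine (norm_Dmlog_mul_right_sub_self_le_general hε (hWl r) _).trans ?_
    exact mul_le_mul_of_nonneg_left (hAl r) (by positivity)
  have hSn : ‖S‖ ≤ ℓ := norm_wsum_le L hL hAl
  have hDX : ‖DXavg L W A q κ‖ ≤ 10 * ε * ℓ + ℓ := by
    have h := norm_add_le (DXavg L W A q κ - S) S
    rw [sub_add_cancel] at h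
    linarith
  have hΦ := norm_PhiY_sub_self_le hX hε (DXavg L W A q κ)
  have key : ‖PhiY (Xavg L W q κ) (DXavg L W A q κ) - S‖ ≤ 8 * ε * (10 * ε * ℓ + ℓ) + 10 * ε * ℓ := by
    have h := norm_add_le (PhiY (Xavg L W q κ) (DXavg L W A q κ) - DXavg L W A q κ) (DXavg L W A q κ - S)
    rw [sub_add_sub_cancel] at h
    have h8 : 8 * ε * ‖DXavg L W A q κ‖ ≤ 8 * ε * (10 * ε * ℓ + ℓ) := mul_le_mul_of_nonneg_left hDX (by positivity)
    linarith
  have h8 : 8 * ε ≤ 1 := by linarith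
  have h6 : 0 ≤ 10 * ε * ℓ := by positivity
  have hε2 : 8 * ε * (10 * ε * ℓ) ≤ 10 * ε * ℓ := by
    calc 8 * ε * (10 * ε * ℓ) ≤ 1 * (10 * ε * ℓ) := mul_le_mul_of_nonneg_right h8 h6
      _ = 10 * ε * ℓ := one_mul _
  have e : 8 * ε * (10 * ε * ℓ + ℓ) = 8 * ε * (10 * ε * ℓ) + 8 * ε * ℓ := by ring
  calc ‖PhiY (Xavg L W q κ) (DXavg L W A q κ) - S‖ ≤ 8 * ε * (10 * ε * ℓ + ℓ) + 10 * ε * ℓ := key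
    _ ≤ 28 * ε * ℓ := by rw [e]; linarith
    _ = 56 * (d + 1) * ε * Λ * L * a := by rw [hℓ]; ring

include hM hWb ha hA hL hΛ hε0 hε hWl in
/-- SECOND BRACKET at `W`: `≤ 12·ε·Λ·L·a`. [cite: Balaban1985Averaging, Proposition 7 p.43, (124)–(126) p.36] -/
theorem norm_bracket2_le_general :
    ‖conjR (expUnit (Xavg L W q κ)) (tsum W A q (seg κ L))
        - ∑ r : Fin d → Fin L, (((L : ℝ) ^ d)⁻¹) • conjR (Wcx L W q κ (boxVec L r)) (tsum W A q (seg κ L))‖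
      ≤ 12 * ε * Λ * L * a := by
  set Rc := tsum W A q (seg κ L) with hRc
  have hΛ0 : 0 ≤ Λ := le_trans (pow_nonneg (by linarith) _) hΛ
  have hR : ‖Rc‖ ≤ L * Λ * a := by
    have h := norm_tsum_le_of_length L hM hWb ha hA hΛ q (w := seg κ (L : ℤ))
      (by rw [length_seg, Int.natAbs_natCast]; omega)
    rwa [length_seg, Int.natAbs_natCast] at h
  have hX := norm_Xavg_le L hL W q κ hε hWl
  have h1 : ‖conjR (expUnit (Xavg L W q κ)) Rc - Rc‖ ≤ 8 * ε * ‖Rc‖ := norm_conjR_expUnit_sub_self_le hX hε Rc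
  have h2 : ‖∑ r : Fin d → Fin L, (((L : ℝ) ^ d)⁻¹) • conjR (Wcx L W q κ (boxVec L r)) Rc - Rc‖ ≤ 4 * ε * ‖Rc‖ := by
    have e : ∑ r : Fin d → Fin L, (((L : ℝ) ^ d)⁻¹) • conjR (Wcx L W q κ (boxVec L r)) Rc - Rc
        = ∑ r : Fin d → Fin L, (((L : ℝ) ^ d)⁻¹) • (conjR (Wcx L W q κ (boxVec L r)) Rc - Rc) := by
      simp_rw [smul_sub]
      rw [Finset.sum_sub_distrib, sum_blockWeight (d := d) L hL Rc]
    rw [e]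
    exact norm_wsum_le L hL fun r => norm_conjR_sub_self_le_general (hWl r) hε Rc
  have h := norm_sub_le (conjR (expUnit (Xavg L W q κ)) Rc - Rc)
    (∑ r : Fin d → Fin L, (((L : ℝ) ^ d)⁻¹) • conjR (Wcx L W q κ (boxVec L r)) Rc - Rc)
  rw [sub_sub_sub_cancel_right] at h
  have h82 : 8 * ε * ‖Rc‖ + 4 * ε * ‖Rc‖ ≤ 12 * ε * (L * Λ * a) := by nlinarith
  linarith

include hM hWb ha hA hL hΛ hε0 hε hWl in
/-- THIRD BRACKET at `W`: `≤ 12·d·ε·Λ·L·a` (the rotation `R(W(c))` by the straight transport and the tree sums at `c₊` together use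
`≤ (d+1)L ≤ (2d+2)L` background bonds). [cite: Balaban1985Averaging, Proposition 7 p.43, (124)–(126) p.36] -/
theorem norm_bracket3_le_general :
    ‖∑ r : Fin d → Fin L, (((L : ℝ) ^ d)⁻¹) •
        (conjR (expUnit (Xavg L W q κ))
            (conjR (hol W q (seg κ L)) (tsum W A (q + (L : ℤ) • e κ) (treeWord (boxVec L r))))
          - conjR (Wcx L W q κ (boxVec L r))
            (conjR (hol W q (seg κ L)) (tsum W A (q + (L : ℤ) • e κ) (treeWord (boxVec L r)))))‖
      ≤ 12 * d * ε * Λ * L * a := by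
  have hX := norm_Xavg_le L hL W q κ hε hWl
  have hM0 : 0 ≤ M := by linarith
  have hΛ0 : 0 ≤ Λ := le_trans (pow_nonneg hM0 _) hΛ
  refine norm_wsum_le L hL fun r => ?_
  set Y := conjR (hol W q (seg κ L)) (tsum W A (q + (L : ℤ) • e κ) (treeWord (boxVec L r))) with hY
  have hYn : ‖Y‖ ≤ d * L * Λ * a := by
    refine (norm_conjR_hol_le hM hWb q _ _).trans ?_
    have ht := norm_tsum_le_general hM hWb ha hA (q + (L : ℤ) • e κ) (treeWord (boxVec L r))
    rw [length_treeWord] at ht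
    rw [length_seg, Int.natAbs_natCast]
    have hl := l1_boxVec_le L r
    have hpow : M ^ (2 * L) * M ^ (2 * l1 (boxVec L r)) ≤ Λ := by
      rw [← pow_add]
      exact (pow_le_pow_right₀ hM (by nlinarith)).trans hΛ
    have hl' : (l1 (boxVec L r) : ℝ) ≤ d * L := by exact_mod_cast hl
    calc M ^ (2 * L) * ‖tsum W A (q + (L : ℤ) • e κ) (treeWord (boxVec L r))‖
        ≤ M ^ (2 * L) * ((l1 (boxVec L r)) * M ^ (2 * l1 (boxVec L r)) * a) := mul_le_mul_of_nonneg_left ht (pow_nonneg hM0 _)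
      _ = (M ^ (2 * L) * M ^ (2 * l1 (boxVec L r))) * ((l1 (boxVec L r)) * a) := by ring
      _ ≤ Λ * (d * L * a) := mul_le_mul hpow (mul_le_mul_of_nonneg_right hl' ha) (by positivity) hΛ0
      _ = d * L * Λ * a := by ring
  have h1 := norm_conjR_expUnit_sub_self_le hX hε Y
  have h2 := norm_conjR_sub_self_le_general (hWl r) hε Y
  have h := norm_sub_le (conjR (expUnit (Xavg L W q κ)) Y - Y) (conjR (Wcx L W q κ (boxVec L r)) Y - Y)
  rw [sub_sub_sub_cancel_right] at h
  have hd : (0 : ℝ) ≤ d := Nat.cast_nonneg d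
  have h82 : 8 * ε * ‖Y‖ + 4 * ε * ‖Y‖ ≤ 12 * d * ε * Λ * L * a := by nlinarith
  linarith

include hM hWb ha hA hL hΛ hε0 hε hWl in
/-- **(126) AT A NON-UNITARY BACKGROUND — THE LINEAR PART IS THE MAIN TERM UP TO `O(ε)·Λ`**:
`‖L(Q(W)A)_c − L·(Q₀A)_c‖ ≤ 68(d+1)·ε·Λ·L·a`. [cite: Balaban1985Averaging, Proposition 7 p.43, (124)–(126) p.36] -/
theorem norm_linQcov_sub_main_le_general :
    ‖linQcov L W A q κ - (L : ℝ) • Q0cov L W A q κ‖ ≤ 68 * (d + 1) * ε * Λ * L * a := by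
  have hW1 : ∀ r : Fin d → Fin L, ‖((Wcx L W q κ (boxVec L r) : 𝔸ˣ) : 𝔸) - 1‖ < 1 :=
    fun r => (hWl r).trans_lt (by linarith)
  have h1 := norm_bracket1_le_general L hM hWb ha hA hL hΛ q κ hε0 hε hWl
  have h2 := norm_bracket2_le_general L hM hWb ha hA hL hΛ q κ hε0 hε hWl
  have h3 := norm_bracket3_le_general L hM hWb ha hA hL hΛ q κ hε0 hε hWl
  rw [linQcov_split L hL W A q κ hW1, add_assoc, add_assoc, add_sub_cancel_left]
  refine (norm_add_le _ _).trans ?_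
  refine (add_le_add h1 ((norm_add_le _ _).trans (add_le_add h2 h3))).trans ?_
  have hd : (0 : ℝ) ≤ d := Nat.cast_nonneg d
  have hΛ0 : 0 ≤ Λ := le_trans (pow_nonneg (by linarith) _) hΛ
  nlinarith [mul_nonneg (mul_nonneg (mul_nonneg hε0 hΛ0) (Nat.cast_nonneg L)) ha]

include hM hWb ha hA hL hΛ hε0 hε hWl in
/-- **(126) at a non-unitary background**: `‖L(Q(W)A)_c‖ ≤ Λ·(1 + 68(d+1)ε)·L·a` — print's «(1 + O(1)L²α₀)» with the extra transport factor
`Λ = |W||W⁻¹|`-type growth «e^{O(1)Lα₁}». [cite: Balaban1985Averaging, Proposition 7 p.43, (126) p.36] -/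
theorem norm_linQcov_le_general : ‖linQcov L W A q κ‖ ≤ Λ * (1 + 68 * (d + 1) * ε) * (L * a) := by
  have hmain : ‖(L : ℝ) • Q0cov L W A q κ‖ ≤ L * (Λ * a) := by
    rw [norm_smul, Real.norm_of_nonneg (Nat.cast_nonneg L)]
    exact mul_le_mul_of_nonneg_left (norm_Q0cov_le_general L hM hWb ha hA hL hΛ q κ) (Nat.cast_nonneg L)
  have h := norm_linQcov_sub_main_le_general L hM hWb ha hA hL hΛ q κ hε0 hε hWl
  have h' := norm_add_le (linQcov L W A q κ - (L : ℝ) • Q0cov L W A q κ) ((L : ℝ) • Q0cov L W A q κ)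
  rw [sub_add_cancel] at h'
  nlinarith

end Brackets

/-! ## §3 (126) at the complex background `U″V₀`: leading coefficient `L`, corrections `O(L²α₀ + Lα₁)` -/

section Complex

/-- **PROPOSITION 7, THE MODIFIED (126) — «the constant e^{O(1)L²α₀} on the right-hand side is replaced by e^{O(1)(L²α₀+Lα₁)}»**: for
`V₀` unit-bounded with block loops at `c = (q, κ)` within `α ≤ 1/16` of `1` (print's `|Y_x| = O(L²α₀)` via Prop. 1), a unit-valued
perturbation `U″` with `‖U″(b) − 1‖, ‖U″(b)⁻¹ − 1‖ ≤ u` and `s := (2d+2)L·u ≤ 1/512` (print's `Lα₁`), and `sup_b|A_b| ≤ a`: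
`‖L(Q(U″V₀)A)_c‖ ≤ (1 + 70(d+1)·α + 150(d+1)·s)·L·a` — leading coefficient EXACTLY `L`, every `O(1)` depending on `d` only.
Mechanism: the block loops of `U″V₀` are within `ε ≤ 2s + α + 2sα` of `1` (`B7Prop7OneStep`: `W_x(U″V₀) = (R^{V₀}_{0}U″)(loop)·W_x(V₀)`),
the transports cost `Λ = (1+u)^{2(2d+2)L} ≤ 1 + 4s`, and §2. [cite: Balaban1985Averaging, Proposition 7 p.43, (126) p.36] -/
theorem norm_linQcov_cplx_le (hL : 1 ≤ L) {V₀ U'' : Site d → Fin d → 𝔸ˣ} (hV₀ : ∀ x κ, V₀ x κ ∈ U1 𝔸) {u : ℝ} (hu : 0 ≤ u)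
    (hU : ∀ x κ, ‖((U'' x κ : 𝔸ˣ) : 𝔸) - 1‖ ≤ u ∧ ‖(((U'' x κ)⁻¹ : 𝔸ˣ) : 𝔸) - 1‖ ≤ u)
    (hun : ((2 * (d * L) + L + L : ℕ) : ℝ) * u ≤ 1 / 512)
    {A : Site d → Fin d → 𝔸} {a : ℝ} (ha : 0 ≤ a) (hA : ∀ x κ, ‖A x κ‖ ≤ a)
    (q : Site d) (κ : Fin d) {α : ℝ} (hα1 : α ≤ 1 / 16)
    (hreg : ∀ r : Fin d → Fin L, ‖((Wcx L V₀ q κ (boxVec L r) : 𝔸ˣ) : 𝔸) - 1‖ ≤ α) :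
    ‖linQcov L (U'' * V₀) A q κ‖
      ≤ (1 + 70 * (d + 1) * α + 150 * (d + 1) * (((2 * (d * L) + L + L : ℕ) : ℝ) * u)) * (L * a) := by
  set n : ℕ := 2 * (d * L) + L + L with hn
  set s : ℝ := (n : ℝ) * u with hs
  have hs0 : 0 ≤ s := by positivity
  have hα0 : 0 ≤ α := by
    have := hreg (fun _ => ⟨0, by omega⟩)
    exact (norm_nonneg _).trans this
  -- the transport growth `Λ = (1+u)^{2n} ≤ e^{2s} ≤ 1 + 4s`
  have hΛ : (1 + u) ^ (2 * n) ≤ 1 + 4 * s := by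
    have h1 : (1 + u) ^ (2 * n) ≤ Real.exp (2 * s) := by
      rw [hs, show 2 * ((n : ℝ) * u) = ((2 * n : ℕ) : ℝ) * u by push_cast; ring, Real.exp_nat_mul]
      exact pow_le_pow_left₀ (by positivity) (by linarith [Real.add_one_le_exp u]) _
    have h2 := exp_sub_one_le_of_le (le_refl (2 * s)) (by positivity) (by linarith)
    linarith
  -- the block loops of `W = U″V₀` at `c`: `ε ≤ 2s + α + 2sα ≤ 1/8`
  have hloopU : ∀ r : Fin d → Fin L,
      ‖((tHol V₀ U'' q (gammaWord L κ (boxVec L r) ++ seg κ (-(L : ℤ))) : 𝔸ˣ) : 𝔸) - 1‖ ≤ 2 * s := by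
    intro r
    have hlen : (gammaWord L κ (boxVec L r) ++ seg κ (-(L : ℤ))).length ≤ n := by
      rw [List.length_append, length_gammaWord, length_seg, Int.natAbs_neg, Int.natAbs_natCast]
      have := l1_boxVec_le (L := L) r; omega
    refine (norm_tHol_pert_sub_one_le hV₀ hu hU _ q).trans ?_
    have hle : (((gammaWord L κ (boxVec L r) ++ seg κ (-(L : ℤ))).length : ℕ) : ℝ) * u ≤ s :=
      (mul_le_mul_of_nonneg_right (by exact_mod_cast hlen) hu)
    exact exp_sub_one_le_of_le hle hs0 (by linarith)
  have hWl : ∀ r : Fin d → Fin L,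
      ‖((Wcx L (U'' * V₀) q κ (boxVec L r) : 𝔸ˣ) : 𝔸) - 1‖ ≤ 2 * s + α + 2 * s * α := by
    intro r
    rw [Wcx_mul_eq_tHol_mul, Units.val_mul]
    have hX := hloopU r
    have hY := hreg r
    have h : ((tHol V₀ U'' q (gammaWord L κ (boxVec L r) ++ seg κ (-(L : ℤ))) : 𝔸ˣ) : 𝔸) *
        ((Wcx L V₀ q κ (boxVec L r) : 𝔸ˣ) : 𝔸) - 1
        = (((tHol V₀ U'' q (gammaWord L κ (boxVec L r) ++ seg κ (-(L : ℤ))) : 𝔸ˣ) : 𝔸) - 1) *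
            (((Wcx L V₀ q κ (boxVec L r) : 𝔸ˣ) : 𝔸) - 1)
          + (((tHol V₀ U'' q (gammaWord L κ (boxVec L r) ++ seg κ (-(L : ℤ))) : 𝔸ˣ) : 𝔸) - 1)
          + (((Wcx L V₀ q κ (boxVec L r) : 𝔸ˣ) : 𝔸) - 1) := by noncomm_ring
    rw [h]
    calc _ ≤ ‖(((tHol V₀ U'' q (gammaWord L κ (boxVec L r) ++ seg κ (-(L : ℤ))) : 𝔸ˣ) : 𝔸) - 1) *
            (((Wcx L V₀ q κ (boxVec L r) : 𝔸ˣ) : 𝔸) - 1)‖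
          + ‖((tHol V₀ U'' q (gammaWord L κ (boxVec L r) ++ seg κ (-(L : ℤ))) : 𝔸ˣ) : 𝔸) - 1‖
          + ‖((Wcx L V₀ q κ (boxVec L r) : 𝔸ˣ) : 𝔸) - 1‖ := norm_add₃_le
      _ ≤ 2 * s * α + 2 * s + α := by
          gcongr
          exact (norm_mul_le _ _).trans (mul_le_mul hX hY (norm_nonneg _) (by positivity))
      _ = 2 * s + α + 2 * s * α := by ring
  have hε8 : 2 * s + α + 2 * s * α ≤ 1 / 8 := by nlinarith
  -- §2 at `W = U″V₀` with `M = 1 + u`, `Λ = 1 + 4s`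
  have h := norm_linQcov_le_general L (W := U'' * V₀) (M := 1 + u) (by linarith) (norm_bond_cplx_le hV₀ hU) ha hA hL
    (Λ := 1 + 4 * s) hΛ q κ (by positivity) hε8 hWl
  refine h.trans (mul_le_mul_of_nonneg_right ?_ (by positivity))
  have hd : (0 : ℝ) ≤ d := Nat.cast_nonneg d
  have hs1 : s ≤ 1 / 512 := hun
  nlinarith [mul_nonneg hs0 hα0, mul_nonneg (mul_nonneg hs0 hα0) hd, mul_nonneg hs0 hd, mul_nonneg hα0 hd,
    mul_nonneg (mul_nonneg hs0 hs0) hd, mul_nonneg hs0 hs0, mul_nonneg (mul_nonneg hs0 hs0) hα0,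
    mul_nonneg (mul_nonneg (mul_nonneg hs0 hs0) hα0) hd]

/-- **the modified (126) in plaquette currency**: `V₀` unit-bounded with `pdev V₀ < β ≤ 1/(512(d+1)(d+4)L²)` («|V₀(∂p) − 1| < α₀», via Prop. 1:
block loops within `16(d+1)(d+4)L²β ≤ 1/32`), `U″` and `A` as above ⟹
`‖L(Q(U″V₀)A)_c‖ ≤ (1 + 1120(d+1)²(d+4)L²·β + 150(d+1)·(2d+2)L·u)·L·a` at EVERY `L`-bond `c` — print's `(1 + O(1)(L²α₀ + Lα₁))`.
[cite: Balaban1985Averaging, Proposition 7 p.43, (126) p.36, (109) p.34] -/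
theorem norm_linQcov_cplx_le_of_pdev (hL : 1 ≤ L) {V₀ U'' : Site d → Fin d → 𝔸ˣ} (hV₀ : ∀ x κ, V₀ x κ ∈ U1 𝔸)
    {β : ℝ} (hβ0 : 0 ≤ β) (hβ : pdev V₀ < β) (hβmax : β ≤ 1 / (512 * ((d : ℝ) + 1) * ((d : ℝ) + 4) * (L : ℝ) ^ 2))
    {u : ℝ} (hu : 0 ≤ u) (hU : ∀ x κ, ‖((U'' x κ : 𝔸ˣ) : 𝔸) - 1‖ ≤ u ∧ ‖(((U'' x κ)⁻¹ : 𝔸ˣ) : 𝔸) - 1‖ ≤ u)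
    (hun : ((2 * (d * L) + L + L : ℕ) : ℝ) * u ≤ 1 / 512)
    {A : Site d → Fin d → 𝔸} {a : ℝ} (ha : 0 ≤ a) (hA : ∀ x κ, ‖A x κ‖ ≤ a) (q : Site d) (κ : Fin d) :
    ‖linQcov L (U'' * V₀) A q κ‖
      ≤ (1 + 1120 * ((d : ℝ) + 1) ^ 2 * ((d : ℝ) + 4) * (L : ℝ) ^ 2 * β
          + 150 * (d + 1) * (((2 * (d * L) + L + L : ℕ) : ℝ) * u)) * (L * a) := by
  have hL0 : (0 : ℝ) < L := by exact_mod_cast hL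
  have hX : (0 : ℝ) < 512 * ((d : ℝ) + 1) * ((d : ℝ) + 4) * (L : ℝ) ^ 2 := by positivity
  have hXβ : 512 * ((d : ℝ) + 1) * ((d : ℝ) + 4) * (L : ℝ) ^ 2 * β ≤ 1 := by
    have := mul_le_mul_of_nonneg_left hβmax hX.le
    rwa [one_div, mul_inv_cancel₀ hX.ne'] at this
  -- block loops of `V₀` from Prop. 1 (`B7Prop2Explicit.norm_Wcx_sub_one_le` needs `512(d+1)(d+4)L²α₀ ≤ 1`, here `α₀ = β`)
  have hreg : ∀ r : Fin d → Fin L,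
      ‖((Wcx L V₀ q κ (boxVec L r) : 𝔸ˣ) : 𝔸) - 1‖ ≤ 16 * ((d : ℝ) + 1) * ((d : ℝ) + 4) * (L : ℝ) ^ 2 * β := by
    intro r
    have h := norm_Wcx_sub_one_le L hL V₀ hV₀ hβ0 hXβ
      (fun x κ₁ κ₂ _ => (le_pdev hV₀ x κ₁ κ₂).trans hβ.le) q κ r
    refine h.trans (le_of_eq ?_); ring
  have hα1 : 16 * ((d : ℝ) + 1) * ((d : ℝ) + 4) * (L : ℝ) ^ 2 * β ≤ 1 / 16 := by nlinarith
  refine (norm_linQcov_cplx_le L hL hV₀ hu hU hun ha hA q κ hα1 hreg).trans (le_of_eq ?_)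
  ring

end Complex

end Literature.MathematicalPhysics.QuantumFieldTheory.Balaban1983to89.B7Prop7LinearBound

end
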